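import Mathlib

/-!
# The CRZ arithmetic of line `cgy-variance-pivot` fails beyond `f ≤ 3.08` (negative lemma for crux stmt-SmoothPoincare4-10870)

The picked line `cgy-variance-pivot` for crux `EntropyRung.CompactShrinkerGap` reaches its transfer target,
the variance budget `D < 2V − 96π²` (`D = ∫(R−2)² dV`, `V = Vol`), along the Cheng–Ribeiro–Zhou sub-line
from three real inequalities (`varianceBudget_arith` of `Lines/cgy-variance-pivot.lean`): the density floor
`Z₀ = 32π²√π e^{-3/2} < Z = ∫e^{-f} dV`, Jensen `Z ≤ e^{-2}V`, and the CRZ coarea bound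
`D ≤ ½(e^{c}Z − V)` at `c = 3 ≥ sup f` (the named hypothesis `PotentialLeThree`). This file records
that the constant `3` is essentially the CEILING of that arithmetic: at `c = 3.1` the same three
inequalities no longer imply the budget (explicit witness `V = 94π²`, `Z = e^{-2}V`,
`D = ½(e^{3.1}Z − V) = 47π²(e^{1.1} − 1) > 92π² = 2V − 96π²`). PAPER: the exact ceiling is
`c* = 2 + log(5 − 6/(√π e^{1/2})) = 3.0807`, so `PotentialLeThree` cannot be relaxed to `f ≤ 3.1`
inside the sub-line; the slack at `c = 3` is below `3 %`. Refuter negative lemma (cdisprove gen 3),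
supports the crux item; pure real arithmetic.
-/

namespace Summit.SmoothPoincare4.SmoothPoincare4.Theorems.CompactShrinkerGap.Negative

/-- **The CRZ sub-line's arithmetic does not survive `c = 3.1`**: it is FALSE that for all reals
`V, Z, D`, the density floor `32π²√π e^{-3/2} < Z`, Jensen `Z ≤ e^{-2}V` and the Cheng–Ribeiro–Zhou
bound `D ≤ ½(e^{31/10}Z − V)` imply the variance budget `D < 2V − 96π²`. Witness: `V = 94π²`,
`Z = e^{-2}·94π²` (admissible since `32√π e^{1/2} < 32·1.7725·1.6488 < 94`), `D = ½(e^{31/10}Z − V)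
= 47π²(e^{11/10} − 1) ≥ 47π²(1.1·e − 1) > 92π²`. Compare `varianceBudget_arith` (the same
implication at `c = 3`, proved in the line's skeleton). [folklore] -/
theorem crzArithmetic_false_at_exp_three_point_one :
    ¬ (∀ V Z D : ℝ,
        32 * Real.pi ^ 2 * Real.sqrt Real.pi * Real.exp (-(3 : ℝ) / 2) < Z →
        Z ≤ Real.exp (-2) * V →
        D ≤ 1 / 2 * (Real.exp (31 / 10) * Z - V) →
        D < 2 * V - 96 * Real.pi ^ 2) := by
  intro h
  have hπ := Real.pi_pos
  have hp2 : 0 < Real.pi ^ 2 := by positivity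
  -- admissibility of `Z = e^{-2}·94π²`: `32 √π e^{-3/2} < 94 e^{-2}`
  have hZ : 32 * Real.pi ^ 2 * Real.sqrt Real.pi * Real.exp (-(3 : ℝ) / 2) <
      Real.exp (-2) * (94 * Real.pi ^ 2) := by
    have hs : Real.sqrt Real.pi < 1.7725 := by
      rw [Real.sqrt_lt' (by norm_num)]
      have := Real.pi_lt_d6; nlinarith
    have he : Real.exp (1 / 2) < 1.6488 := by
      have h2 : Real.exp (1 / 2) ^ 2 < (1.6488 : ℝ) ^ 2 := by
        rw [← Real.exp_nat_mul]; norm_num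
        have := Real.exp_one_lt_d9; linarith
      exact lt_of_pow_lt_pow_left₀ 2 (by norm_num) h2
    have hprod : Real.sqrt Real.pi * Real.exp (1 / 2) < 1.7725 * 1.6488 :=
      mul_lt_mul'' hs he (Real.sqrt_nonneg _) (Real.exp_pos _).le
    have hE : Real.exp (-(3 : ℝ) / 2) = Real.exp (-2) * Real.exp (1 / 2) := by
      rw [← Real.exp_add]; norm_num
    rw [hE]
    have h2 := Real.exp_pos (-2 : ℝ)
    nlinarith [mul_pos h2 hp2]
  have hlt := h (94 * Real.pi ^ 2) (Real.exp (-2) * (94 * Real.pi ^ 2))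
    (1 / 2 * (Real.exp (31 / 10) * (Real.exp (-2) * (94 * Real.pi ^ 2)) - 94 * Real.pi ^ 2)) hZ le_rfl le_rfl
  -- but `47π²(e^{1.1} − 1) ≥ 92π²`
  have hE : Real.exp (31 / 10) * Real.exp (-2) = Real.exp (11 / 10) := by
    rw [← Real.exp_add]; norm_num
  have h11 : Real.exp (11 / 10 : ℝ) = Real.exp 1 * Real.exp (1 / 10) := by
    rw [← Real.exp_add]; norm_num
  have hlow : (2.99 : ℝ) < Real.exp (11 / 10) := by
    rw [h11]
    have h1 := Real.exp_one_gt_d9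
    have h2 : (1 / 10 : ℝ) + 1 ≤ Real.exp (1 / 10) := Real.add_one_le_exp _
    nlinarith [Real.exp_pos (1 / 10 : ℝ)]
  have key : 1 / 2 * (Real.exp (31 / 10) * (Real.exp (-2) * (94 * Real.pi ^ 2)) - 94 * Real.pi ^ 2)
      = 47 * Real.pi ^ 2 * (Real.exp (31 / 10) * Real.exp (-2) - 1) := by ring
  rw [key, hE] at hlt
  nlinarith

end Summit.SmoothPoincare4.SmoothPoincare4.Theorems.CompactShrinkerGap.Negative
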